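import Mathlib
import HarnessLib
import HarnessLib.Audit
import Summits.MatrixMultiplication.Statement
import Literature.Computability.AlgebraicComplexity.GroupTheoreticMatMul
import Literature.Computability.AlgebraicComplexity.GroupTheoreticMatMulProofs
import Literature.Computability.AlgebraicComplexity.FlatteningBound
import HarnessLib.Audit.Status.Attr

/-!
Route: DefinableSTPPDichotomy

DORMANT since 2026-08-24T05:41:45Z (reconciler: no traction for 6.6 d (last activity item-evidence-added at 2026-08-17T15:16:04Z); parked, not closed — `ledger route dormant route-MatrixMultiplication-DefinableSTPPDichotomy --off` to re) — unstaffed, not closed; items shared with open routes are served there. `ledger route dormant <id> --off` reactivates.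

# Route DefinableSTPPDichotomy — curved definable STPP tiles in bounded rank decide omega; pairwise
compatibility is the dodge, hexagon clearance the seam

RESCUER route (lens 3.8), successor of the refuted route AlgebraicSTPPDichotomy (killed by the
proved
`Literature.Barriers.MatrixMultiplication.BoundedRankFrameBarrier`: no dimension-exact STPP design
of punctured-subspace
FRAMES in any bounded rank m over F_q, q → ∞; the engine — richness lemma + second moment — uses
that frames are CONES,
closed under F^×). Its explicit rank-2 crux IS the barrier's own declared evasion: NON-CONICAL
(curved) DEFINABLE tiles.
It suffices to show X = ExactDefinableDesign — ring-language formulas φ_I, φ_A, φ_B, φ_C (parameters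
y ∈ F^k, fixed complexity)
such that for every ε > 0, arbitrarily large finite fields F realise an STPP family (CKSU 2005 Def
5.1, the tree's clause,
indexed by the definable set I(F) ⊂ F^e) in H = F^m with Σ_x (|A_x||B_x||C_x|)^((2+ε)/3) > |F|^m; X
→ ω(ℂ) = 2 is CKSU Thm 5.5
(abelian, PROVED in tree). X is reached through TWO cruxes, both posed in the route's own regime of
LARGE CHARACTERISTIC since the repair of
2026-08-17 (rev 2–4): PairwiseCurvedTilingsLC (the dodge: in fields of arbitrarily large
characteristic, ≍ q^e near-tiling
blocks satisfying every STPP pattern with two equal labels, at exact mass — exactly what full-frame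
rigidity denies to cones,
≤ 2 blocks) and HexagonClearanceR (the seam: for small ε and large characteristic, a pairwise-clean
exact-mass family keeps a
FULLY STPP sub-family that still beats |F|^m — the 3-label "hexagon" violations clear at
sub-polynomial cost). The original
seam HexagonClearance (∀ ε > 0, all fields, loss |F|^δ) was refuted-MISSTATED by
`DefinableSTPPDichotomyHexagonClearance_refuted`
(ε = 4, characteristic 3: a label-only line/point/point parasite whose clean sub-families are cap
sets) and is kept only in the
negatives index; the repaired pair excludes the whole parasite class (TranslateFamiliesFail) and the
bounded-exponent fields
where Thm B forbids the conclusion. `closes` reaches ω(ℂ) = 2 directly from the two cruxes (CKSU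
5.5); X itself is the moral
target (the clean sub-family J need not be definable, so LC ∧ R → X is not claimed as bookkeeping).
Lean: `∃ (e m k : ℕ) (φI : FirstOrder.Language.ring.Formula (Fin e ⊕ Fin k)) (φA φB φC :
FirstOrder.Language.ring.Formula ((Fin e ⊕ Fin m) ⊕ Fin k)), ∀ ε : ℝ, 0 < ε → ∀ q₀ : ℕ, ∃ (F : Type)
(_ : Field F) (_ : Fintype F) (_ : FirstOrder.Ring.CompatibleRing F), q₀ ≤ Fintype.card F ∧ ∃ (y :
Fin k → F) (I : Finset (Fin e → F)) (A B C : (Fin e → F) → Finset (Fin m → F)), (∀ x, x ∈ I ↔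
φI.Realize (Sum.elim x y)) ∧ (∀ x v, v ∈ A x ↔ φA.Realize (Sum.elim (Sum.elim x v) y)) ∧ (∀ x v, v ∈
B x ↔ φB.Realize (Sum.elim (Sum.elim x v) y)) ∧ (∀ x v, v ∈ C x ↔ φC.Realize (Sum.elim (Sum.elim x
v) y)) ∧ (∀ i ∈ I, ∀ j ∈ I, ∀ k ∈ I, ∀ s ∈ A k, ∀ s' ∈ A i, ∀ t ∈ B i, ∀ t' ∈ B j, ∀ u ∈ C j, ∀ u' ∈
C k, (s' - s) + (t' - t) + (u' - u) = 0 → i = j ∧ j = k ∧ s = s' ∧ t = t' ∧ u = u') ∧ (Fintype.card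
F : ℝ) ^ (m : ℝ) < ∑ x ∈ I, (((A x).card * (B x).card * (C x).card : ℕ) : ℝ) ^ ((2 + ε) / 3)`

## Assembly
The deciding theorem `closes (h₁ : PairwiseCurvedTilingsLC) (h₂ : HexagonClearanceR) :
_root_.MatrixMultiplication` is PROVED
sorry-free (repair planner's glue.lean / Sketch.lean rc 0, axioms
propext/Classical.choice/Quot.sound; gate audit native OK at rev 3):
by `MatrixMultiplication_iff` and `omega_two_le` it remains to refute ω > 2; h₁ gives the formulas,
h₂ an ε₀ > 0 for them; put
ε := min(ω − 2, ε₀); h₁ at ε gives η > 0 and, for the q₁ supplied by h₂ at (ε, η), a field F of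
characteristic ≥ q₁ with a realised
pairwise-clean family of mass ≥ |F|^(m+η) at exponent (2+ε)/3; h₂ extracts J ⊆ I with the full
clause and |F|^m < Σ_J (abc)^((2+ε)/3);
since (2+ε)/3 ≤ ω/3 and each base is a natural number the same sum at exponent ω/3 is no smaller;
re-indexing J by `Fin J.card`
turns the element-indexed clause into the tree's `IsSTPP`, and
`CohnKleinbergSzegedyUmans2005_5_5_abelian_holds` in H = Fin m → F
bounds it by |F^m| = |F|^m — absurd. Both hypotheses are load-bearing (cone = 2); the item
`Assembly` records the type of `closes`.

Rationale: WHY THIS LINE. The bounded-rank abelian regime (H = F_q^m, m fixed, q → ∞) is the one host family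
where neither proved engine bites:
Blasiak–Church–Cohn–Grochow–Naslund–Sawin–Umans Thm B (tree, `TricoloredSumFreeBarrier`) needs
bounded EXPONENT (a witness
sequence here has char F → ∞), and the bounded-rank frame barrier (tree, 2026-08-15) needs cones;
its `evasions_known` line
names "definable non-linear sets such as tori and norm-one hypersurfaces", and the standing
disprover's census of the moot item
stmt-7624 (Cruxes/DefinableDesignBarrier/Disproof.lean §4(d)) locates the first cell: Θ(q) curved
full-weight (1,1,1) blocks in
F_q^3 ((2,1,1) in F^4), "the one place full-frame rigidity does not reach". Imported: model theory /
arithmetic geometry of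
finite fields (ChatzidakisVanDenDriesMacintyre1992 sizes μq^d; Kowalski2007 Fourier decay of
definable sets; Tao2015AlgebraicRegularity)
for both the construction ansatz (pore sets as character patterns, level-surface packings) and the
kill side; additive
combinatorics for the hexagon seam (Peluse2017-type two-parameter counts). What no prior route does:
ConeDesigns and the corpse
stake CONES (dead under the same barrier); EisensteinValCertificates prices homocyclic hosts through
Pratt2024's Val (conditional);
AutomaticSTPPDesigns lives in rank one (Z_(p^k), digit structure); this route stakes the design
class, not the group class, and
its negation DefinableDesignBarrier is the unconditional bounded-rank companion of Thm B for all
definable designs.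
REPAIR 2026-08-17 (rev 2–4). The regime "char F → ∞" is now written INTO both cruxes (`q₀ ≤ ringChar
F`, `q₁ ≤ ringChar F`)
instead of being left to Thm B, and the seam is asked only for small ε (∃ ε₀) with the weakest
conclusion `closes` needs
(|F|^m < mass_J): the refutation of the original seam used exactly the two freedoms removed (ε = 4;
characteristic 3).

RANKED CRUXES. #0 ExactDefinableDesign (target) — some ring formulas (φ_I; φ_A, φ_B, φ_C) of fixed
complexity such that for every ε > 0 and every q₀ some finite field F with |F| ≥ q₀ and parameters y
realise a family (A_x, B_x, C_x)_{x ∈ I(F)} in F^m satisfying the tree's STPP clause (indexed by the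
elements of I) with |F|^m < Σ_x (|A_x||B_x||C_x|)^((2+ε)/3); the positive form of
¬DefinableDesignBarrier (moot stmt-7624). (why it might fail: DefinableDesignBarrier may simply
hold: definable dense sets are Fourier-pseudorandom in large characteristic (Kowalski2007 Thm 14),
miss only O(1) differences, and every closed case has O(1) full blocks; Pratt2024 Cor 4.5 kills all
bounded-rank hosts conditionally on Val(Z_n) ≤ n^(1+o(1)).) [CohnKleinbergSzegedyUmans2005,
Kowalski2007, Pratt2024, ChatzidakisVanDenDriesMacintyre1992,
lean:Literature.Barriers.MatrixMultiplication.BoundedRankFrameBarrier]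
#2 PairwiseCurvedTilingsLC (crux) — THE DODGE, large-characteristic form (rev 2; supersedes the
dropped PairwiseCurvedTilings stmt-18074, which it implies trivially since ringChar F ≤ |F| — the
refuter's ATTACK.md on stmt-18074 applies verbatim). Ring formulas of fixed complexity such that for
every ε > 0 there is η > 0 with: finite fields F of arbitrarily large CHARACTERISTIC realise a
definable family (A_x,B_x,C_x)_{x∈I(F)} in F^m satisfying the STPP clause for every label triple
with AT LEAST TWO EQUAL entries (block TPP + the three 2-label patterns = the three colour-class
packings with their porosity) and the exact-mass bound |F|^(m+η) ≤ Σ_x (|A_x||B_x||C_x|)^((2+ε)/3).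
Counting (abelian TPP abc ≤ q^m; packings Σab, Σbc, Σac ≤ q^m) forces for ε < 1/m the tight
numerology (d,d,d), e = m − 2d ≥ 1, ≍ q^e blocks; translate families are impossible for ε ≤ 1
(TranslateFamiliesFail); full frames allow ≤ 2 blocks; bounded characteristic would be worthless
anyway (Thm B denies clearance there). [difficulty: open-problem] (why it might fail: full-frame
rigidity may extend to all definable tiles: block TPP makes U_x+(B_x−B_x)∖0 avoid U_x, so pattern
(i,i,k) forces these translates into the common pore set; definable dense sets miss only O(1)
differences (Weil), suggesting O(1) compatible full-weight blocks, in every characteristic.)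
[CohnKleinbergSzegedyUmans2005, BlasiakChurchCohnGrochowNaslundSawinUmans2017, Kowalski2007,
Tao2015AlgebraicRegularity, lean:Literature.Barriers.MatrixMultiplication.BoundedRankFrameBarrier]
#3 HexagonClearanceR (crux) — THE SEAM, repaired (rev 2): for all ring formulas there is ε₀ > 0 such
that for all 0 < ε ≤ ε₀ and η > 0 there is q₁ with: in every finite field F of CHARACTERISTIC ≥ q₁,
every realised definable family in F^m that satisfies all ≥2-equal-label STPP patterns and the mass
bound |F|^(m+η) ≤ Σ_I (|A||B||C|)^((2+ε)/3) contains a sub-family J ⊆ I satisfying the FULL STPP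
clause with |F|^m < Σ_J (|A||B||C|)^((2+ε)/3) — at exact mass, in large characteristic, the
3-distinct-label (tricoloured, "hexagon") violations of a tight pairwise tiling clear at
sub-polynomial cost. The three provisos are the content of the repair, none cosmetic: small ε (tight
regime; kills the translate/label-only CLASS, TranslateFamiliesFail), large characteristic (removes
the bounded-exponent fields where `BCCGNSU2017_thmB_elementary` makes the conclusion impossible for
ε ≤ 3c_p, so the old item hid a "pairwise Thm B"), and the δ-free conclusion (the weakest `closes`
needs; `closes` applies both cruxes at ε = min(ω−2, ε₀) and uses monotonicity in the exponent).
[difficulty: L] (why it might fail: if tight definable pairwise tilings exist, their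
3-distinct-label violations follow algebraic label relations; for NONLINEAR relations power-saving
Roth-type counts (Peluse2017, Bourgain–Chang) cap clean sub-families at |I|·q^(−c), and any fixed c
> 0 refutes (take ε < c/d).) [BlasiakChurchCohnGrochowNaslundSawinUmans2017, Peluse2017,
Tao2015AlgebraicRegularity, CohnKleinbergSzegedyUmans2005,
lean:Summit.MatrixMultiplication.MatrixMultiplication.Theorems.DefinableSTPPDichotomyHexagonClearance_refuted]
SETTLED NEGATIVE EDGE (dropped at rev 4, kept in `ledger negatives`): HexagonClearance (stmt-18075,
ex-#3; ∀ ε, η, δ > 0, all fields |F| ≥ q₁, loss |F|^δ) — FALSE,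
`Summit.MatrixMultiplication.MatrixMultiplication.Theorems.DefinableSTPPDichotomyHexagonClearance_refuted`
(Theorems/DefinableSTPPDichotomyHexagonClearanceRefutation.lean, p141567, refuted-misstated: ε = 4,
F = GF(3ⁿ), m = 2, A_x = {x}×F, B_x = {0}, C_x = {(−x,−x)}; clean sub-families = cap sets ≤
3q^(1−c₃)). PROVER NOTE (fix item for that Theorems file): since rev 4 the constant
`…Theses.DefinableSTPPDichotomy.HexagonClearance` is no longer rendered in this file, so the
refutation file must re-declare `def HexagonClearance : Prop := <the statement recorded in ledger
negatives / stmt-18075>` VERBATIM in its own namespace (pattern of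
Theorems/DesignFlatteningSeparableDesignsMultiplicativeRefutation.lean after DesignFlattening rev 5,
ThinBlockAlpha rev 6) and refute that; nothing else in the tree names it. Also dropped at rev 4:
PairwiseCurvedTilings (stmt-18074, superseded by the LC form; moot, not refuted) and TilingsToExact
(stmt-18076: vacuous once its second hypothesis was refuted, and not bookkeeping anyway — the clean
sub-family J ⊆ I is not cut out by φ_I, so "tilings + clearance ⇒ ExactDefinableDesign" does not
follow formally; `closes` never needed it).
#9 TranslateFamiliesFail (support, rev 2) — provable now (M), the formal record of why the repair is
not cosmetic: in any finite abelian group H a TRANSLATE family A_x = α(x)+A, B_x = β(x)+B, C_x =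
γ(x)+C (x ∈ I; one fixed triple) that satisfies the ≥2-equal-label patterns has Σ_{x∈I}
(|A||B||C|)^((2+ε)/3) ≤ |H| for every 0 < ε ≤ 1 (pattern i=j=k is the TPP of (A,B,C), so T = A+B+C
has |T| = |A||B||C|; pattern (i,i,k) with t = t′ says the shifts (α−γ)(x) have pairwise differences
outside T − T, so the translates (α−γ)(x)+T are disjoint: |I|·|A||B||C| ≤ |H|; and (abc)^((2+ε)/3) ≤
abc). Hence no label-only family ever meets the hypotheses of #2/#3. [difficulty: M]
[CohnKleinbergSzegedyUmans2005, BlasiakChurchCohnGrochowNaslundSawinUmans2017]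
#9 KillLink (support) — provable now, the kill link: ExactDefinableDesign → ω(ℂ) = 2 (re-index I by
Fin |I|, CKSU Thm 5.5 abelian in H = F^m with ε := ω − 2, `omega_two_le`; the body of `closes`, cf.
Disproof.lean §0 `matrixMultiplication_of_not`). [difficulty: provable-now]
[CohnKleinbergSzegedyUmans2005,
lean:Literature.Computability.AlgebraicComplexity.CohnKleinbergSzegedyUmans2005_5_5_abelian_holds,
lean:Literature.Computability.AlgebraicComplexity.omega_two_le]
#9 DefinableDesignBarrier (support) — NEGATIVE SIDE / KILL CRITERION (re-typing of moot stmt-7624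
with the element-indexed clause): for all ring formulas there are ε > 0 and q₀ such that every
realised definable STPP family in F^m, |F| ≥ q₀, has Σ_x (|A_x||B_x||C_x|)^((2+ε)/3) ≤ |F|^m — the
bounded-RANK companion of Thm B for all definable designs; proving it closes the route refuted with
a new catalogue entry (route to it: CDM sizes + Fourier decay of definable sets ⇒ coset structure ⇒
frames ⇒ BoundedRankFrameBarrier). [difficulty: XL] [ChatzidakisVanDenDriesMacintyre1992,
Kowalski2007, Tao2015AlgebraicRegularity, CohnKleinbergSzegedyUmans2005]
#9 BarrierIffNotExact (support) — bookkeeping, provable now (push_neg, not_lt):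
DefinableDesignBarrier ↔ ¬ExactDefinableDesign; a proof of the barrier is a one-line refutation of
the target. [difficulty: provable-now] [CohnKleinbergSzegedyUmans2005]
#9 RankThreeDefinableNoGo (support) — NEGATIVE MILESTONE (the cheapest falsifier made formal;
generalises the proved RankThreeNoGo "≤ 2 full frame blocks in F^3" from cones to all definable
tiles): for all ring formulas with m = 3 and every μ > 0 there are K, q₀ such that in every |F| ≥ q₀
every realised family satisfying the ≥2-equal-label patterns has at most K blocks whose three sets
all have size ≥ μ|F| (full-weight curved blocks are boundedly many). Its proof kills the rank-3 cell
of PairwiseCurvedTilings and is evidence toward DefinableDesignBarrier. [difficulty: L]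
[CohnKleinbergSzegedyUmans2005, Kowalski2007]

TWO-LAYER PLAN. Foreseen glued splits (none filed now; birth skeletons in the planner folder bc/):
PairwiseCurvedTilingsLC ⇐ PorousTilings →
PorosityCriterion → PairwiseCurvedTilingsLC (pore-set form: three colour packings with common
definable pore sets P₁,P₂,P₃ hosting
every non-zero inner-difference translate; the criterion is a true M-sized lemma), then
PorousTilings ⇐ per-numerology children
(3;1,1,1) full-weight curved tiles | (4;1,1,1) | (6;2,2,2). HexagonClearanceR ⇐ HexHittingSet →
HittingToSTPP → HexagonClearanceR
(sparse hexagon violations admit a hitting set leaving mass > |F|^m; removal of a hitting set from a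
pairwise-clean family is STPP;
the planner's birth skeletons of 02:22Z are typed against the OLD decls and must be re-cut against
LC / R by the crux planner).

KILL CRITERIA. DefinableDesignBarrier proved (⇔ ¬ExactDefinableDesign, BarrierIffNotExact) ⇒ close
`refuted:ExactDefinableDesign` with the
barrier handed to Literature/Barriers/MatrixMultiplication as the bounded-rank definable companion
of Thm B (the honest negative
outcome, exactly as the corpse ended). ¬PairwiseCurvedTilingsLC proved (e.g. via
RankThreeDefinableNoGo-type finiteness at every
numerology, which refutes the weaker all-characteristic form too) ⇒ close
`refuted:PairwiseCurvedTilingsLC`. HexagonClearanceR refuted ⇒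
read the witness: after the repair it can only be a TIGHT large-characteristic definable pairwise
tiling with power-sparse clean
sub-families, i.e. an LC-witness — pivot to its cleaning problem (restate the seam for that family /
its label relations) rather than
close; a refutation by anything cheaper means the seam is misstated again and is repaired, not
conceded (rev 2–4 did exactly this
for the ε = 4 / characteristic-3 parasite). PrimeValConjecture
(route EisensteinValCertificates) proved ⇒ prime-field hosts die by Pratt2024 Cor 4.5: restrict to
prime powers or close.
GroupTheoreticSTPP.CThesis or HomocyclicSTPPDesigns proved elsewhere ⇒ ω = 2, route moot.

NOT DECOMPOSED YET. The numerology children of the dodge ((3;1,1,1), (4;1,1,1), (6;2,2,2)); the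
choice between polynomial-image (unirational) tiles
and general definable tiles; character-pattern pore sets (quadratic-residue level sets) as the first
ansatz; the coset step on
the kill side (Kowalski decay ⇒ affine structure) and CDM multiplicities; prime fields versus prime
powers of LARGE primes (subfield tiles; small characteristic is now excluded by
hypothesis — Thm B denies clearance there); the label relations governing hexagon violations (linear
⇒ Behrend-type q^(−o(1)) loss,
nonlinear ⇒ power saving) once a tiling exists; non-abelian wrappers (other routes).

CHEAPEST FALSIFIER. RankThreeDefinableNoGo by the MISSING-DIFFERENCES lemma: a definable Y ⊂ F with
|Y| ≥ μ|F| has |F ∖ (Y−Y)| = O(1) (Parseval +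
square-root cancellation), and block TPP + pattern (i,i,k) force, after projecting the pore
condition U_x + (B_x−B_x)^* ⊆ P₁
along a packing direction, a label set whose difference set avoids Y − Y — so O(1) labels; worked by
hand for the triangular
ansatz A = graph curve, B = plane curve, C = partial axis (dead: O(1) blocks) in NOTES.md. Kit
census not run this cycle: count
pairwise-compatible full-weight curve-triple blocks of degree ≤ 2 in F_p^3, p ≤ 13 (refuter's first
job; frames give exactly 2).
For the repaired seam there is no cheaper falsifier than an LC-type tight tiling (label-only /
translate families and bounded
characteristic are excluded by TranslateFamiliesFail and by hypothesis), which is the intended order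
of attack: #2 before #3.

NUMBERS. Packing (BCCGNSU Lemma 2.4): Σ_x |A_x||B_x| ≤ q^m per pairing ⇒ exact mass forces (d,d,d),
e = m − 2d, N ≍ q^e, tight in all
three pairings. Frame barrier: ε_m = 2/(6m+5), q₀ = 81; ≤ 9q^(m−3)(1+o(1)) STPP line triples in
F_q^m; full frames ≤ 2 blocks
(|F| ≥ 5). Bounded blocks of size ≤ a certify nothing below ε_a = log_a(2 − a^(−2)) (ε_2 ≈ 0.807;
Alder–Strassen, census (c)).
Thm B at exponent p saves only 0.8415^m (no power of q). Items at open: 9 (target, 2 cruxes, 5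
supports, assembly). Items after the repair (rev 4): 9 active (target,
cruxes PairwiseCurvedTilingsLC / HexagonClearanceR, supports KillLink, DefinableDesignBarrier,
BarrierIffNotExact, RankThreeDefinableNoGo,
TranslateFamiliesFail, assembly) + 3 dropped (HexagonClearance refuted; PairwiseCurvedTilings
superseded; TilingsToExact). Translate
families: mass ≤ q^m·(abc)^((ε−1)/3) ≤ q^m for ε ≤ 1; the parasite needed ε ≥ 1 + 3η. Thm B
elementary: no fully-STPP J beats q^m at
ε ≤ 3c_p in characteristic p (3c_3 = 0.2325, 3c_101 = 0.1100).

DEFINITION REQUESTS. None: the statements use Mathlib's `FirstOrder.Language.ring.Formula`,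
`FirstOrder.Ring.CompatibleRing`, `Formula.Realize`
(the typing of stmt-7624, which elaborated), Mathlib's `ringChar` for the characteristic proviso,
and the tree's STPP clause inlined element-wise. A Literature definition
`IsPairwiseSTPP` / `DefinableFamily` would shorten the decls; not requested (inline text is the
source of truth).

Novelty: Searches (2026-08-17): `lit search --hybrid "simultaneous triple product property construction
algebraic curves finite field definable sets"` (8 book hits, model-theory texts, none on STPP); `lit
search --source zbmath "triple product property matrix multiplication group-theoretic construction"`
(1: arXiv:2410.14905 BCGPU 2025, finite from infinite groups); `… "uniquely solvable puzzles matrix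
multiplication constructions search"` (1: arXiv:2307.06463, USP search); `… "exponential sums over
definable subsets of finite fields"` (Kowalski2007); `… "expanding polynomials … definable sets"`
(Tao2015AlgebraicRegularity); `… "three-term polynomial progressions in subsets of finite fields"`
(Peluse2017); `lit galaxy search "simultaneous triple product property" --star all` (5: Landsberg
GCT, Sawin arXiv:1702.00905, Stothers thesis ×2, CKSU05) and `"uniquely solvable puzzle" --star all`
(9, none on definable/curved designs); precomputed `lit frontier MatrixMultiplication --since 2023`
(60 rows, none on bounded-rank definable designs); openalex/s2/arxiv rate-limited this session
(recorded).
Nearest prior art found: CohnKleinbergSzegedyUmans2005 §5–7 (abelian STPP, local USP designs at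
unbounded rank); BlasiakChurchCohnGrochowNaslundSawinUmans2017 Thm B (bounded exponent); Pratt2024
Cor 4.5 (bounded rank killed CONDITIONALLY on Val); in-tree `BoundedRankFrameBarrier` (frames, this
project) and the moot census stmt-7624; nearest routes ConeDesigns (cones),
EisensteinValCertificates (hom  [refs: 2410.14905, 2307.06463, 1702.00905, Kowalski2007, Peluse2017, CohnKleinbergSzegedyUmans2005, BlasiakChurchCohnGrochowNaslundSawinUmans2017, Pratt2024]

Barriers (technique_class: abelian-STPP, definable-designs, bounded-rank): - technique_class: abelian-STPP, definable-designs, bounded-rank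
- Literature.Barriers.MatrixMultiplication.BoundedRankFrameBarrier: evaded BY HYPOTHESIS and by name
— its richness lemma needs colour classes closed under F^× (cones over subspaces) and TPP-direct
V⊕W⊕U; curved definable tiles are its own `evasions_known`; conceded: frames inside our class stay
dead (≤ 2 full blocks, ≤ 9q^(m−3) line triples), so every witness must be genuinely curved.
- Literature.Barriers.MatrixMultiplication.TricoloredSumFreeBarrier: evaded by hypothesis — Thm B
(tree, `not_beats_of_exponent_le`) needs exponent ≤ ℓ; H = F^m has exponent char F and a witness
sequence (ε → 0) must have char F → ∞, which bounded RANK allows; at fixed characteristic the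
barrier PROVES our negative side (Disproof gen-1 `fixed_char`), consistently.
- Literature.Barriers.MatrixMultiplication.InfimumNotMinimumBarrier: respected — closes produces ω ≤
2 + … for every ε and concludes ω = 2 as an infimum; no O(n²) algorithm claimed.
- Literature.Barriers.MatrixMultiplication.EquivoluminousBarrier: n/a — no Coppersmith–Winograd
combinatorial hypothesis; designs are read through CKSU 5.5 only.
- Literature.Barriers.MatrixMultiplication.NilpotentGroupBarrier, NormalizerBarrier,
QuasirandomBarrier, YoungSubgroupBarrier: n/a — abelian hosts (class 1, all character degrees 1, no
subgroups/S_n).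
- Literature.Barriers.MatrixMultiplication.IrreversibilityBarrier, UniversalMethodBarrier,
UnstableTensorBarrier, RectangularBarrier,

History (route lifecycle, newest last):
- 2026-08-17T04:27:41Z · BROKEN — HexagonClearance (stmt-MatrixMultiplication-18075, crux) refuted by Summit.MatrixMultiplication.MatrixMultiplication.Theorems.DefinableSTPPDichotomyHexagonClearance_refuted @ 60503d4c6b1d (refuter-rattack-stmt-MatrixMultiplication-18075-0)
- 2026-08-17T04:53:20Z · rev 4: restated Assembly (stmt-MatrixMultiplication-18081) — repair step 3/3 (route-repair unit): DROP the refuted ex-seam HexagonClearance (stmt-18075, refuted-misstated by DefinableSTPPDichotomyHexagonClearance_refuted; (planner-rfix-MatrixMultiplication-DefinableS-41ed9f66-0)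
- 2026-08-17T04:53:20Z · rev 4: dropped HexagonClearance, PairwiseCurvedTilings, TilingsToExact — repair step 3/3 (route-repair unit): DROP the refuted ex-seam HexagonClearance (stmt-18075, refuted-misstated by DefinableSTPPDichotomyHexagonClearance_refuted; (planner-rfix-MatrixMultiplication-DefinableS-41ed9f66-0)
- 2026-08-17T04:53:20Z · REPAIRED (restate Assembly; drop HexagonClearance, PairwiseCurvedTilings, TilingsToExact) — back to open: repair step 3/3 (route-repair unit): DROP the refuted ex-seam HexagonClearance (stmt-18075, refuted-misstated by DefinableSTPPDichotomyHexagonClearance_refuted; (planner-rfix-MatrixMultiplication-DefinableS-41ed9f66-0)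
- 2026-08-24T05:41:45Z · DORMANT — reconciler: no traction for 6.6 d (last activity item-evidence-added at 2026-08-17T15:16:04Z); parked, not closed — `ledger route dormant route-MatrixMultiplica (operator:999:3420463)

sub-problem: MatrixMultiplication · status: dormant · opened planner-plan-lens3-MatrixMultiplication-rescuer-0 2026-08-17T02:20:14Z · rev 4 · ledger route-MatrixMultiplication-DefinableSTPPDichotomy
GENERATED by the gate from the ledger (D-0016/17). Provers cite these decls: `theorem foo : Summit.MatrixMultiplication.MatrixMultiplication.Theses.DefinableSTPPDichotomy.<Decl> := …` in Summits/MatrixMultiplication/MatrixMultiplication/Theorems/<Name>.lean.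
-/

namespace Summit.MatrixMultiplication.MatrixMultiplication.Theses.DefinableSTPPDichotomy

open scoped BigOperators Topology Manifold Classical MeasureTheory ProbabilityTheory Matrix InnerProductSpace ComplexConjugate ContinuousMap
open Filter Set Function TopologicalSpace MeasureTheory

attribute [summit_statement] _root_.MatrixMultiplication

/-- item stmt-MatrixMultiplication-18073 · target · rank 0 · open · by planner
why it might fail: DefinableDesignBarrier may simply hold: definable dense sets are Fourier-pseudorandom in large characteristic (Kowalski2007 Thm 14), miss only O(1) differences, and every closed case has O(1) full blocks; Pratt2024 Cor 4.5 kills all bounded-rank hosts conditionally on Val(Z_n) ≤ n^(1+o(1)).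
sources: CohnKleinbergSzegedyUmans2005, Kowalski2007, Pratt2024, ChatzidakisVanDenDriesMacintyre1992, lean:Literature.Barriers.MatrixMultiplication.BoundedRankFrameBarrier
[target] some ring formulas (φ_I; φ_A, φ_B, φ_C) of fixed complexity such that for every ε > 0 and
every q₀ some finite field F with |F| ≥ q₀ and parameters y realise a family (A_x, B_x, C_x)_{x ∈
I(F)} in F^m satisfying the tree's STPP clause (indexed by the elements of I) with |F|^m < Σ_x
(|A_x||B_x||C_x|)^((2+ε)/3); the positive form of ¬DefinableDesignBarrier (moot stmt-7624). -/
@[route_item "route-MatrixMultiplication-DefinableSTPPDichotomy"]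
def ExactDefinableDesign : Prop :=
  ∃ (e m k : ℕ) (φI : FirstOrder.Language.ring.Formula (Fin e ⊕ Fin k)) (φA φB φC : FirstOrder.Language.ring.Formula ((Fin e ⊕ Fin m) ⊕ Fin k)), ∀ ε : ℝ, 0 < ε → ∀ q₀ : ℕ, ∃ (F : Type) (_ : Field F) (_ : Fintype F) (_ : FirstOrder.Ring.CompatibleRing F), q₀ ≤ Fintype.card F ∧ ∃ (y : Fin k → F) (I : Finset (Fin e → F)) (A B C : (Fin e → F) → Finset (Fin m → F)), (∀ x, x ∈ I ↔ φI.Realize (Sum.elim x y)) ∧ (∀ x v, v ∈ A x ↔ φA.Realize (Sum.elim (Sum.elim x v) y)) ∧ (∀ x v, v ∈ B x ↔ φB.Realize (Sum.elim (Sum.elim x v) y)) ∧ (∀ x v, v ∈ C x ↔ φC.Realize (Sum.elim (Sum.elim x v) y)) ∧ (∀ i ∈ I, ∀ j ∈ I, ∀ k ∈ I, ∀ s ∈ A k, ∀ s' ∈ A i, ∀ t ∈ B i, ∀ t' ∈ B j, ∀ u ∈ C j, ∀ u' ∈ C k, (s' - s) + (t' - t) + (u' - u) = 0 → i = j ∧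 j = k ∧ s = s' ∧ t = t' ∧ u = u') ∧ (Fintype.card F : ℝ) ^ (m : ℝ) < ∑ x ∈ I, (((A x).card * (B x).card * (C x).card : ℕ) : ℝ) ^ ((2 + ε) / 3)

/-- item stmt-MatrixMultiplication-17883 · crux · rank 2 · open · by planner
why it might fail: full-frame rigidity may extend to all definable tiles: block TPP makes U_x+(B_x−B_x)∖0 avoid U_x, so pattern (i,i,k) forces these translates into the common pore set; definable dense sets miss only O(1) differences (Weil) ⇒ O(1) compatible full-weight blocks, in every characteristic.
sources: CohnKleinbergSzegedyUmans2005, BlasiakChurchCohnGrochowNaslundSawinUmans2017, Kowalski2007, Tao2015AlgebraicRegularity, lean:Literature.Barriers.MatrixMultiplication.BoundedRankFrameBarrier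
[crux] THE DODGE, large-characteristic form (repair 2026-08-17; supersedes PairwiseCurvedTilings
stmt-MatrixMultiplication-18074: `q₀ ≤ ringChar F` replaces `q₀ ≤ Fintype.card F` — the route's own
regime char F → ∞, needed so that `closes` can feed the repaired seam HexagonClearanceR; LC → old
statement trivially (ringChar F ≤ |F|), so every line of the refuter's ATTACK.md on stmt-18074
applies verbatim). Ring formulas (φ_I; φ_A, φ_B, φ_C) of fixed complexity such that for every ε > 0
there is η > 0 with: finite fields F of arbitrarily large CHARACTERISTIC realise, with parameters y,
a definable family (A_x,B_x,C_x)_{x∈I(F)} in F^m satisfying the STPP clause for every label triple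
with AT LEAST TWO EQUAL entries (block TPP + the three 2-label patterns = the three colour-class
packings A−B, B−C, A−C with their porosity) and the exact-mass bound |F|^(m+η) ≤ Σ_x
(|A_x||B_x||C_x|)^((2+ε)/3). Counting (abelian TPP ⇒ abc ≤ q^m; the 2-label patterns ⇒ Σab, Σbc, Σac
≤ q^m) forces for ε < 1/m the tight numerology (d,d,d), e = m − 2d ≥ 1, ≍ q^e blocks, all three
pairings tight; translate families (A_x = α(x)+A, …) are impossible for ε ≤ 1
(TranslateFamiliesFail); full frames allow ≤ 2 blocks -/
@[route_item "route-MatrixMultiplication-DefinableSTPPDichotomy", crux]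
def PairwiseCurvedTilingsLC : Prop :=
  ∃ (e m k : ℕ) (φI : FirstOrder.Language.ring.Formula (Fin e ⊕ Fin k)) (φA φB φC : FirstOrder.Language.ring.Formula ((Fin e ⊕ Fin m) ⊕ Fin k)), ∀ ε : ℝ, 0 < ε → ∃ η : ℝ, 0 < η ∧ ∀ q₀ : ℕ, ∃ (F : Type) (_ : Field F) (_ : Fintype F) (_ : FirstOrder.Ring.CompatibleRing F), q₀ ≤ ringChar F ∧ ∃ (y : Fin k → F) (I : Finset (Fin e → F)) (A B C : (Fin e → F) → Finset (Fin m → F)), (∀ x, x ∈ I ↔ φI.Realize (Sum.elim x y)) ∧ (∀ x v, v ∈ A x ↔ φA.Realize (Sum.elim (Sum.elim x v) y)) ∧ (∀ x v, v ∈ B x ↔ φB.Realize (Sum.elim (Sum.elim x v) y)) ∧ (∀ x v, v ∈ C x ↔ φC.Realize (Sum.elim (Sum.elim x v) y)) ∧ (∀ i ∈ I, ∀ j ∈ I, ∀ k ∈ I, (i = j ∨ j = k ∨ k = i) → ∀ s ∈ A k, ∀ s' ∈ A i, ∀ t ∈ B i, ∀ t' ∈ B j, ∀ u ∈ C j, ∀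 u' ∈ C k, (s' - s) + (t' - t) + (u' - u) = 0 → i = j ∧ j = k ∧ s = s' ∧ t = t' ∧ u = u') ∧ (Fintype.card F : ℝ) ^ ((m : ℝ) + η) ≤ ∑ x ∈ I, (((A x).card * (B x).card * (C x).card : ℕ) : ℝ) ^ ((2 + ε) / 3)

/-- item stmt-MatrixMultiplication-17884 · crux · rank 3 · open · by planner
why it might fail: if tight definable pairwise tilings exist, their 3-distinct-label violations follow algebraic label relations; for NONLINEAR relations power-saving Roth-type counts (Peluse2017, Bourgain–Chang) cap clean sub-families at |I|·q^(−c), and any fixed c > 0 refutes (take ε < c/d).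
sources: BlasiakChurchCohnGrochowNaslundSawinUmans2017, Peluse2017, Tao2015AlgebraicRegularity, CohnKleinbergSzegedyUmans2005, lean:Summit.MatrixMultiplication.MatrixMultiplication.Theorems.DefinableSTPPDichotomyHexagonClearance_refuted
[crux] THE SEAM, repaired (2026-08-17). HexagonClearance (stmt-MatrixMultiplication-18075) was
refuted-MISSTATED by Theorems/DefinableSTPPDichotomyHexagonClearanceRefutation.lean
(`DefinableSTPPDichotomyHexagonClearance_refuted`): it asked clearance for EVERY ε > 0 in EVERY
finite field, and at ε = 4 in characteristic 3 a label-only parasite (A_x a line, B_x, C_x points in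
F², x ∈ F) meets both hypotheses while its fully-STPP sub-families are cap sets (≤ 3q^(1−c₃), tree
`card_le_rpow_of_elementary`). Repaired statement = exactly what `closes` consumes: for all ring
formulas there is ε₀ > 0 such that for all 0 < ε ≤ ε₀ and η > 0 there is q₁ with: in every finite
field of CHARACTERISTIC ≥ q₁, every realised definable family in F^m satisfying all ≥2-equal-label
STPP patterns with |F|^(m+η) ≤ Σ_I (|A||B||C|)^((2+ε)/3) contains a sub-family J ⊆ I satisfying the
FULL STPP clause that still beats |F|^m at the same exponent. Each proviso is forced, none cosmetic:
(i) small ε (∃ε₀; `closes` applies both cruxes at ε' = min(ω−2, ε₀) and uses monotonicity of the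
mass in the exponent) puts the hypothesis in the tight (d,d,d) regime and excludes the whole
translate/label-only CLASS, not just the -/
@[route_item "route-MatrixMultiplication-DefinableSTPPDichotomy", crux]
def HexagonClearanceR : Prop :=
  ∀ (e m k : ℕ) (φI : FirstOrder.Language.ring.Formula (Fin e ⊕ Fin k)) (φA φB φC : FirstOrder.Language.ring.Formula ((Fin e ⊕ Fin m) ⊕ Fin k)), ∃ ε₀ : ℝ, 0 < ε₀ ∧ ∀ ε η : ℝ, 0 < ε → ε ≤ ε₀ → 0 < η → ∃ q₁ : ℕ, ∀ (F : Type) [Field F] [Fintype F] [FirstOrder.Ring.CompatibleRing F], q₁ ≤ ringChar F → ∀ (y : Fin k → F) (I : Finset (Fin e → F)) (A B C : (Fin e → F) → Finset (Fin m → F)), (∀ x, x ∈ I ↔ φI.Realize (Sum.elim x y)) → (∀ x v, v ∈ A x ↔ φA.Realize (Sum.elim (Sum.elim x v) y)) → (∀ x v, v ∈ B x ↔ φB.Realize (Sum.elim (Sum.elim x v) y)) → (∀ x v, v ∈ C x ↔ φC.Realize (Sum.elim (Sum.elim x v) y)) → (∀ i ∈ I, ∀ j ∈ I, ∀ k ∈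 I, (i = j ∨ j = k ∨ k = i) → ∀ s ∈ A k, ∀ s' ∈ A i, ∀ t ∈ B i, ∀ t' ∈ B j, ∀ u ∈ C j, ∀ u' ∈ C k, (s' - s) + (t' - t) + (u' - u) = 0 → i = j ∧ j = k ∧ s = s' ∧ t = t' ∧ u = u') → (Fintype.card F : ℝ) ^ ((m : ℝ) + η) ≤ ∑ x ∈ I, (((A x).card * (B x).card * (C x).card : ℕ) : ℝ) ^ ((2 + ε) / 3) → ∃ J : Finset (Fin e → F), J ⊆ I ∧ (∀ i ∈ J, ∀ j ∈ J, ∀ k ∈ J, ∀ s ∈ A k, ∀ s' ∈ A i, ∀ t ∈ B i, ∀ t' ∈ B j, ∀ u ∈ C j, ∀ u' ∈ C k, (s' - s) + (t' - t) + (u' - u) = 0 → i = j ∧ j = k ∧ s = s' ∧ t = t' ∧ u = u') ∧ (Fintype.card F : ℝ) ^ (m : ℝ) < ∑ x ∈ J, (((A x).card * (B x).card * (C x).card : ℕ) : ℝ) ^ ((2 + ε) / 3)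

/-- item stmt-MatrixMultiplication-17885 · support · rank 9 · open · by planner
sources: CohnKleinbergSzegedyUmans2005, BlasiakChurchCohnGrochowNaslundSawinUmans2017
[support] provable now (M; the formal record of why the repair of the seam is not cosmetic): in any
finite abelian group H, a TRANSLATE family A_x = α(x)+A, B_x = β(x)+B, C_x = γ(x)+C (x ∈ I, one
fixed triple A, B, C) that satisfies the ≥2-equal-label STPP patterns has Σ_{x∈I}
(|A||B||C|)^((2+ε)/3) ≤ |H| for every 0 < ε ≤ 1 — so no label-only family ever meets the mass
hypothesis |H|·|F|^η of HexagonClearanceR / PairwiseCurvedTilingsLC. Proof: pattern i=j=k is the TPP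
of (A,B,C), so T := A+B+C has |T| = |A||B||C| ((a,b,c) ↦ a+b+c injective); pattern (i,i,k), k ≠ i,
with t = t' reads (α−γ)(i) − (α−γ)(k) ∉ T − T and forces α−γ injective on I, so the translates
(α−γ)(x) + T, x ∈ I, are pairwise disjoint: |I|·|A||B||C| ≤ |H|; finally (abc)^((2+ε)/3) ≤ abc for
abc ≥ 1 and ε ≤ 1 (abc = 0 contributes 0). [deps: none] [difficulty: M] -/
@[route_item "route-MatrixMultiplication-DefinableSTPPDichotomy"]
def TranslateFamiliesFail : Prop :=
  ∀ (H : Type) [AddCommGroup H] [Fintype H] [DecidableEq H] (ι : Type) (I : Finset ι) (α β γ : ι → H) (A B C : Finset H) (ε : ℝ), 0 < ε → ε ≤ 1 → (∀ i ∈ I, ∀ j ∈ I, ∀ k ∈ I, (i = j ∨ j = k ∨ k = i) → ∀ s ∈ A.image (fun v => α k + v), ∀ s' ∈ A.image (fun v => α i + v), ∀ t ∈ B.image (fun v => β i + v), ∀ t' ∈ B.image (fun v => β j + v), ∀ u ∈ C.image (fun v => γ j + v), ∀ u' ∈ C.image (fun v => γ k + v), (s' - s) + (t' - t) + (u' - u)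 = 0 → i = j ∧ j = k ∧ s = s' ∧ t = t' ∧ u = u') → ∑ _x ∈ I, ((A.card * B.card * C.card : ℕ) : ℝ) ^ ((2 + ε) / 3) ≤ (Fintype.card H : ℝ)

/-- item stmt-MatrixMultiplication-18077 · support · rank 9 · open · by planner
sources: CohnKleinbergSzegedyUmans2005, lean:Literature.Computability.AlgebraicComplexity.CohnKleinbergSzegedyUmans2005_5_5_abelian_holds, lean:Literature.Computability.AlgebraicComplexity.omega_two_le
[support] provable now, the kill link: ExactDefinableDesign → ω(ℂ) = 2 (re-index I by Fin |I|, CKSU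
Thm 5.5 abelian in H = F^m with ε := ω − 2, `omega_two_le`; the body of `closes`, cf. Disproof.lean
§0 `matrixMultiplication_of_not`). [difficulty: provable-now] -/
@[route_item "route-MatrixMultiplication-DefinableSTPPDichotomy"]
def KillLink : Prop :=
  ExactDefinableDesign → _root_.MatrixMultiplication

/-- item stmt-MatrixMultiplication-18078 · support · rank 9 · open · by planner
sources: ChatzidakisVanDenDriesMacintyre1992, Kowalski2007, Tao2015AlgebraicRegularity, CohnKleinbergSzegedyUmans2005
[support] NEGATIVE SIDE / KILL CRITERION (re-typing of moot stmt-7624 with the element-indexed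
clause): for all ring formulas there are ε > 0 and q₀ such that every realised definable STPP family
in F^m, |F| ≥ q₀, has Σ_x (|A_x||B_x||C_x|)^((2+ε)/3) ≤ |F|^m — the bounded-RANK companion of Thm B
for all definable designs; proving it closes the route refuted with a new catalogue entry (route to
it: CDM sizes + Fourier decay of definable sets ⇒ coset structure ⇒ frames ⇒
BoundedRankFrameBarrier). [difficulty: XL] -/
@[route_item "route-MatrixMultiplication-DefinableSTPPDichotomy"]
def DefinableDesignBarrier : Prop :=
  ∀ (e m k : ℕ) (φI : FirstOrder.Language.ring.Formula (Fin e ⊕ Fin k)) (φA φB φC : FirstOrder.Language.ring.Formula ((Fin e ⊕ Fin m) ⊕ Fin k)), ∃ ε : ℝ, 0 < ε ∧ ∃ q₀ : ℕ, ∀ (F : Type) [Field F] [Fintype F] [FirstOrder.Ring.CompatibleRing F], q₀ ≤ Fintype.card F → ∀ (y : Fin k → F) (I : Finset (Fin e → F)) (A B C : (Fin e → F) → Finset (Fin m → F)), (∀ x, x ∈ I ↔ φI.Realize (Sum.elim x y)) → (∀ x v, v ∈ A x ↔ φA.Realize (Sum.elim (Sum.elim x v) y)) → (∀ x v, v ∈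 B x ↔ φB.Realize (Sum.elim (Sum.elim x v) y)) → (∀ x v, v ∈ C x ↔ φC.Realize (Sum.elim (Sum.elim x v) y)) → (∀ i ∈ I, ∀ j ∈ I, ∀ k ∈ I, ∀ s ∈ A k, ∀ s' ∈ A i, ∀ t ∈ B i, ∀ t' ∈ B j, ∀ u ∈ C j, ∀ u' ∈ C k, (s' - s) + (t' - t) + (u' - u) = 0 → i = j ∧ j = k ∧ s = s' ∧ t = t' ∧ u = u') → ∑ x ∈ I, (((A x).card * (B x).card * (C x).card : ℕ) : ℝ) ^ ((2 + ε) / 3) ≤ (Fintype.card F : ℝ) ^ (m : ℝ)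

/-- item stmt-MatrixMultiplication-18079 · support · rank 9 · open · by planner
sources: CohnKleinbergSzegedyUmans2005
[support] bookkeeping, provable now (push_neg, not_lt): DefinableDesignBarrier ↔
¬ExactDefinableDesign; a proof of the barrier is a one-line refutation of the target. [difficulty:
provable-now] -/
@[route_item "route-MatrixMultiplication-DefinableSTPPDichotomy"]
def BarrierIffNotExact : Prop :=
  DefinableDesignBarrier ↔ ¬ ExactDefinableDesign

/-- item stmt-MatrixMultiplication-18080 · support · rank 9 · open · by planner
sources: CohnKleinbergSzegedyUmans2005, Kowalski2007
[support] NEGATIVE MILESTONE (the cheapest falsifier made formal; generalises the proved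
RankThreeNoGo "≤ 2 full frame blocks in F^3" from cones to all definable tiles): for all ring
formulas with m = 3 and every μ > 0 there are K, q₀ such that in every |F| ≥ q₀ every realised
family satisfying the ≥2-equal-label patterns has at most K blocks whose three sets all have size ≥
μ|F| (full-weight curved blocks are boundedly many). Its proof kills the rank-3 cell of
PairwiseCurvedTilings and is evidence toward DefinableDesignBarrier. [difficulty: L] -/
@[route_item "route-MatrixMultiplication-DefinableSTPPDichotomy"]
def RankThreeDefinableNoGo : Prop :=
  ∀ (e k : ℕ) (φI : FirstOrder.Language.ring.Formula (Fin e ⊕ Fin k)) (φA φB φC : FirstOrder.Language.ring.Formula ((Fin e ⊕ Fin 3) ⊕ Fin k)), ∀ μ : ℝ, 0 < μ → ∃ K q₀ : ℕ, ∀ (F : Type) [Field F] [Fintype F] [FirstOrder.Ring.CompatibleRing F], q₀ ≤ Fintype.card F → ∀ (y : Fin k → F) (I : Finset (Fin e → F)) (A B C : (Fin e → F) → Finset (Fin 3 → F)), (∀ x, x ∈ I ↔ φI.Realize (Sum.elim x y)) → (∀ x v, v ∈ A x ↔ φA.Realize (Sum.elim (Sum.elim x v) y)) → (∀ x v, v ∈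 B x ↔ φB.Realize (Sum.elim (Sum.elim x v) y)) → (∀ x v, v ∈ C x ↔ φC.Realize (Sum.elim (Sum.elim x v) y)) → (∀ i ∈ I, ∀ j ∈ I, ∀ k ∈ I, (i = j ∨ j = k ∨ k = i) → ∀ s ∈ A k, ∀ s' ∈ A i, ∀ t ∈ B i, ∀ t' ∈ B j, ∀ u ∈ C j, ∀ u' ∈ C k, (s' - s) + (t' - t) + (u' - u) = 0 → i = j ∧ j = k ∧ s = s' ∧ t = t' ∧ u = u') → ∀ I' : Finset (Fin e → F), I' ⊆ I → (∀ x ∈ I', μ * Fintype.card F ≤ (A x).card ∧ μ * Fintype.card F ≤ (B x).card ∧ μ * Fintype.card F ≤ (C x).card) → I'.card ≤ K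

-- earlier Assembly (stmt-MatrixMultiplication-18081, replaced 2026-08-17T04:53:20Z -> stmt-MatrixMultiplication-17898): retired by None — PairwiseCurvedTilings → HexagonClearance → _root_.MatrixMultiplication
/-- item stmt-MatrixMultiplication-17898 · assembly · rank 1 · open · by planner
sources: CohnKleinbergSzegedyUmans2005, lean:Literature.Computability.AlgebraicComplexity.CohnKleinbergSzegedyUmans2005_5_5_abelian_holds
[assembly] PairwiseCurvedTilingsLC → HexagonClearanceR → ω(ℂ) = 2 — the type of the repaired
`closes` (rev 3; proved sorry-free there). -/
@[route_item "route-MatrixMultiplication-DefinableSTPPDichotomy"]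
def Assembly : Prop :=
  PairwiseCurvedTilingsLC → HexagonClearanceR → _root_.MatrixMultiplication

-- records of items no longer active in this route (dropped / restated):
-- earlier HexagonClearance (stmt-MatrixMultiplication-18075, dropped 2026-08-17T04:53:20Z): refuted by Summit.MatrixMultiplication.MatrixMultiplication.Theorems.DefinableSTPPDichotomyHexagonClearance_refuted @ 60503d4c6b1d — ∀ (e m k : ℕ) (φI : FirstOrder.Language.ring.Formula (Fin e ⊕ Fin k)) (φA φB φC : FirstOrder.Language.ring.Formula ((Fin e ⊕ Fin m) ⊕ Fin k)), ∀ ε η δ : ℝ, 0 < ε → 0 < η → 0 < δ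

/-! D-0027 §2.1 — DECIDING THEOREM (planner-authored via `route open/edit --closes-file`; by planner-rfix-MatrixMultiplication-DefinableS-41ed9f66-0 2026-08-17T04:51:03Z):
its hypotheses are this route's items and its conclusion the sub-problem Statement (glue_lint), and it elaborates with this file. -/

/-- DECIDING THEOREM (D-0027 §2.1; re-glued at the 2026-08-17 repair over the repaired cruxes).  The two
cruxes decide `ω(ℂ) = 2`: if `ω > 2`, `PairwiseCurvedTilingsLC` gives ring formulas; `HexagonClearanceR`
gives for these formulas an `ε₀ > 0`; put `ε := min(ω − 2, ε₀) ∈ (0, ε₀]`.  The dodge at `ε` gives `η > 0`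
and, for every `q₁`, a finite field `F` of characteristic `≥ q₁` carrying a realised definable family in
`F^m` that satisfies every STPP pattern with at least two equal labels and the mass bound
`|F|^{m+η} ≤ Σ_x (|A_x||B_x||C_x|)^{(2+ε)/3}`; the seam (at `ε, η`, characteristic `≥ q₁`) extracts a
genuinely STPP sub-family `J` with `|F|^m < Σ_{x∈J} (|A_x||B_x||C_x|)^{(2+ε)/3}`.  Since `(2+ε)/3 ≤ ω/3`
and every base is a natural number (`0` or `≥ 1`), the same sum at exponent `ω/3` is at least as large;
re-indexing `J` by `Fin |J|` and applying the Cohn–Kleinberg–Szegedy–Umans inequality (CKSU 2005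
Thm 5.5, abelian case, PROVED in the tree as `CohnKleinbergSzegedyUmans2005_5_5_abelian_holds`) in
`H = F^m` bounds it by `|F^m| = |F|^m` — absurd.  Hence `ω ≤ 2`; `2 ≤ ω` is `omega_two_le`.
Both hypotheses are load-bearing. -/
@[closes "route-MatrixMultiplication-DefinableSTPPDichotomy"] theorem closes (h₁ : PairwiseCurvedTilingsLC) (h₂ : HexagonClearanceR) : _root_.MatrixMultiplication := by
  classical
  rw [_root_.MatrixMultiplication_iff]
  refine le_antisymm (not_lt.1 fun hlt => ?_)
    (Literature.Computability.AlgebraicComplexity.omega_two_le ℂ)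
  set ω := Literature.Computability.AlgebraicComplexity.omega ℂ with hω
  obtain ⟨e, m, k, φI, φA, φB, φC, hfam⟩ := h₁
  obtain ⟨ε₀, hε₀, hclear⟩ := h₂ e m k φI φA φB φC
  set ε := min (ω - 2) ε₀ with hεdef
  have hε : 0 < ε := lt_min (by linarith) hε₀
  have hεle : ε ≤ ε₀ := min_le_right _ _
  have hεω : ε ≤ ω - 2 := min_le_left _ _
  obtain ⟨η, hη, hall⟩ := hfam ε hε
  obtain ⟨q₁, hq₁⟩ := hclear ε η hε hεle hη
  obtain ⟨F, instF, instFin, instCR, hq, y, I, A, B, C, hI, hA, hB, hC, hpair, hmass⟩ := hall q₁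
  obtain ⟨J, -, hSTPP, hmassJ⟩ := hq₁ F hq y I A B C hI hA hB hC hpair hmass
  -- re-index the STPP sub-family `J` by `Fin |J|`
  set N := J.card with hN
  let ι : Fin N → (Fin e → F) := fun i => (J.equivFin.symm i : Fin e → F)
  have hιmem : ∀ i, ι i ∈ J := fun i => (J.equivFin.symm i).2
  have hιinj : Function.Injective ι := fun i j hij =>
    J.equivFin.symm.injective (Subtype.ext hij)
  have hST : Literature.Computability.AlgebraicComplexity.IsSTPP
      (fun i => A (ι i)) (fun i => B (ι i)) (fun i => C (ι i)) := by
    intro i j l s hs s' hs' t ht t' ht' u hu u' hu' hsum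
    obtain ⟨hij, hjl, hss, htt, huu⟩ := hSTPP (ι i) (hιmem i) (ι j) (hιmem j) (ι l) (hιmem l)
      s hs s' hs' t ht t' ht' u hu u' hu' hsum
    exact ⟨hιinj hij, hιinj hjl, hss, htt, huu⟩
  have h55 := Literature.Computability.AlgebraicComplexity.CohnKleinbergSzegedyUmans2005_5_5_abelian_holds
    (Fin m → F) N (fun i => A (ι i)) (fun i => B (ι i)) (fun i => C (ι i)) hST
  have hcard : (Fintype.card (Fin m → F) : ℝ) = (Fintype.card F : ℝ) ^ (m : ℝ) := by
    rw [Real.rpow_natCast, Fintype.card_fun, Fintype.card_fin]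
    push_cast
    rfl
  -- monotonicity in the exponent: `(2+ε)/3 ≤ ω/3`, each base a natural number (`0` or `≥ 1`)
  have hmono : ∑ x ∈ J, (((A x).card * (B x).card * (C x).card : ℕ) : ℝ) ^ ((2 + ε) / 3) ≤
      ∑ x ∈ J, (((A x).card * (B x).card * (C x).card : ℕ) : ℝ) ^ (ω / 3) := by
    refine Finset.sum_le_sum fun x _ => ?_
    rcases Nat.eq_zero_or_pos ((A x).card * (B x).card * (C x).card) with h0 | hpos
    · have h1 : (0 : ℝ) < (2 + ε) / 3 := by linarith
      have h2 : (0 : ℝ) < ω / 3 := by linarith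
      rw [h0, Nat.cast_zero, Real.zero_rpow h1.ne', Real.zero_rpow h2.ne']
    · exact Real.rpow_le_rpow_of_exponent_le (by exact_mod_cast hpos) (by linarith)
  have hsum : ∑ x ∈ J, (((A x).card * (B x).card * (C x).card : ℕ) : ℝ) ^ (ω / 3) =
      ∑ i : Fin N, (((A (ι i)).card * (B (ι i)).card * (C (ι i)).card : ℕ) : ℝ) ^ (ω / 3) := by
    rw [← Finset.sum_coe_sort J]
    exact Fintype.sum_equiv J.equivFin _ _ (fun x => by simp [ι])
  have hle : ∑ x ∈ J, (((A x).card * (B x).card * (C x).card : ℕ) : ℝ) ^ ((2 + ε) / 3) ≤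
      (Fintype.card F : ℝ) ^ (m : ℝ) := by
    calc ∑ x ∈ J, (((A x).card * (B x).card * (C x).card : ℕ) : ℝ) ^ ((2 + ε) / 3)
        ≤ ∑ x ∈ J, (((A x).card * (B x).card * (C x).card : ℕ) : ℝ) ^ (ω / 3) := hmono
      _ = ∑ i : Fin N, (((A (ι i)).card * (B (ι i)).card * (C (ι i)).card : ℕ) : ℝ) ^ (ω / 3) := hsum
      _ ≤ (Fintype.card (Fin m → F) : ℝ) := h55
      _ = (Fintype.card F : ℝ) ^ (m : ℝ) := hcard
  exact absurd hmassJ (not_lt.2 hle)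

end Summit.MatrixMultiplication.MatrixMultiplication.Theses.DefinableSTPPDichotomy
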